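import Literature.Topology.FourManifolds.HomotopySpheresStablyParallelizableProofs
import Literature.Topology.FourManifolds.HomotopyS4PuncturedContractible
import Literature.Topology.FourManifolds.HomotopyS4CompactProofs
import Literature.Topology.FourManifolds.HomotopyS4Criterion
import Mathlib.Geometry.Manifold.Metrizable
import Literature.Topology.FourManifolds.ParallelizablePullback
import Literature.Topology.Immersions.OpenParallelizableImmersionHolds
import Literature.Geometry.Manifold.OpenSubmanifoldMFDeriv
import HarnessLib

/-!
# The covering homotopy theorem for tangent frames; the punctured homotopy 4-sphere is parallelizable and immerses in `ℝ⁴`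

Topic `Literature/Topology/FourManifolds`. The UNSTABLE companion of
`HomotopySpheresStablyParallelizableProofs.lean` (which treats frames of `TM ⊕ ℝ`): the same
slab-and-front proof of Steenrod's first covering homotopy theorem, written for frames of `TM`
itself, and its two classical consequences used by the folding programme of
`HomotopyS4FoldMap.lean` (Gromov, *Partial Differential Relations* §2.1.3 (D); see the blueprint in
`HomotopyS4FoldMapProofs.lean`):

* `Literature.Topology.FourManifolds.IsFrameFieldOn` / `frameChartTransportU` and their API
  (`mono`, `comp`, `congr`, `union`, `transport`, `frameChartTransportU_eq_self`) — frame fields of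
  `TM` along a map over a region, pasting along closed sets, chart transport (the local step);
* `Literature.Topology.FourManifolds.HasTangentFramingAlong.homotopy` — **covering homotopy
  theorem for tangent frames**: `TM` framed along `G(0,·)` ⟹ framed along `G(1,·)`, `G` a homotopy
  of a compact metrisable space (Steenrod 1951 §11.3; Hatcher, *Algebraic Topology*, Prop. 4.48);
* `Literature.Topology.FourManifolds.HasTangentFramingAlong.of_homotopic_const` — `TM` is framed
  along every null-homotopic map of a compact metrisable space;
* `Literature.Topology.FourManifolds.hasTangentFramingAlong_compl_singleton_of_contractibleSpace` —
  **bundles over contractible bases are trivial** in the form: `M` compact metrisable, `M ∖ {p}`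
  contractible ⟹ `TM` is framed over `M ∖ {p}` (Steenrod 1951 §11.6);
* `Literature.Topology.FourManifolds.isParallelizable_opens_compl_singleton_of_homotopyEquiv_sphere_four` —
  **a homotopy 4-sphere minus a point is parallelizable** (`Σ⁴ ∖ pt` is contractible,
  `contractibleSpace_compl_singleton_of_homotopyEquiv_sphere_four`, Freedman 1982 p. 371; `Σ⁴` is
  compact, `compactSpace_of_homotopyEquiv_sphere_four_holds`; framings pull back along the open
  inclusion, `IsParallelizable.of_hasTangentFramingAlong_of_isInvertible_mfderiv`);
* `Literature.Topology.FourManifolds.exists_isLocalDiffeomorphAt_compl_singleton_of_homotopyEquiv_sphere_four` —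
  **a smooth homotopy 4-sphere minus a point immerses in `ℝ⁴`** (Phillips 1967, Cor. 8.2, PROVED in
  the tree: `Literature.Topology.Immersions.Phillips1967_exists_isLocalDiffeomorph_of_isParallelizable_holds`,
  applied to the parallelizable proper open subset `M ∖ {q}` of the connected `M`).

Everything is proved; no definition of a notion beyond the two auxiliary predicates/operations of
the proof, no named fact (net debt `0`).

## References

* N. Steenrod, *The Topology of Fibre Bundles* (1951), §11.3–11.6. [folklore]
* A. Hatcher, *Algebraic Topology* (2002), Prop. 4.48. [folklore]
* A. Phillips, *Submersions of open manifolds*, Topology 6 (1967), Cor. 8.2 p. 196. [Phillips1967]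
* M. Gromov, *Partial Differential Relations* (1986), §2.1.3 (D) p. 59 (the use). [Gromov1986]
-/

open scoped Manifold ContDiff Topology unitInterval ContinuousMap
open Set Function Bundle Metric Module

noncomputable section

namespace Literature.Topology.FourManifolds

/-- Local notation: `𝔼 n` is the model Euclidean space `EuclideanSpace ℝ (Fin n)`. -/
local notation "𝔼 " n:arg => EuclideanSpace ℝ (Fin n)

/-! ### Frame fields of `TM` along a map, over a region -/

section FrameField

variable {m : ℕ} {M : Type*} [TopologicalSpace M] [ChartedSpace (𝔼 m) M] [IsManifold (𝓡 m) 1 M]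
  {X X' : Type*} [TopologicalSpace X] [TopologicalSpace X'] {ι : Type*}

/-- **A frame field of `TM` along `G` over the region `R`** (indexed by `ι`): a family
`F q = (F q i)ᵢ` of vectors of `T_{G q} M`, `q ∈ X`, continuous into `TM` on `R` and linearly
independent at every point of `R` — a continuous section over `R` of the (Stiefel) frame bundle of
`M` pulled back along `G` (Steenrod, *The Topology of Fibre Bundles*, §7–8). For `R = univ` and
`ι = Fin (finrank ℝ ℝᵐ)` this is `HasTangentFramingAlong`
(`IsFrameFieldOn.hasTangentFramingAlong`). Unstable analogue of `IsStableFrameFieldOn`.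
[folklore] -/
def IsFrameFieldOn (G : X → M) (F : X → ι → 𝔼 m) (R : Set X) : Prop :=
  (∀ i, ContinuousOn (fun q => (TotalSpace.mk' (𝔼 m) (G q) (F q i) : TangentBundle (𝓡 m) M)) R) ∧
    ∀ q ∈ R, LinearIndependent ℝ (F q)

/-- **Transport of a tangent frame in a chart trivialisation**: the frame at `q` whose
chart-`φ` coordinates are those of the frame `F (ρ q)` at `G (ρ q)`,
`(dφ⁻¹_{φ(G q)} ∘ dφ_{G(ρ q)}) (F (ρ q))` (parallel transport for the flat connection of the
trivialisation `TM|_{φ.source} ≅ φ.source × ℝᵐ`; Steenrod 1951, §11.3). Unstable analogue of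
`frameChartTransport`. [folklore] -/
def frameChartTransportU (φ : OpenPartialHomeomorph M (𝔼 m)) (G : X → M) (F : X → ι → 𝔼 m)
    (ρ : X → X) (q : X) (i : ι) : 𝔼 m :=
  mfderiv (𝓡 m) (𝓡 m) φ.symm (φ (G q)) (mfderiv (𝓡 m) (𝓡 m) φ (G (ρ q)) (F (ρ q) i))

namespace IsFrameFieldOn

variable {G : X → M} {F Φ : X → ι → 𝔼 m} {R P : Set X}

/-- Restriction of a frame field to a smaller region. [folklore] -/
theorem mono (h : IsFrameFieldOn G F R) (hP : P ⊆ R) : IsFrameFieldOn G F P :=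
  ⟨fun i => (h.1 i).mono hP, fun q hq => h.2 q (hP hq)⟩

/-- Pull-back of a frame field along a map `ρ` continuous on `P` with `ρ(P) ⊆ R`. [folklore] -/
theorem comp (h : IsFrameFieldOn G F R) {ρ : X' → X} {P : Set X'} (hρ : ContinuousOn ρ P)
    (hPR : MapsTo ρ P R) : IsFrameFieldOn (G ∘ ρ) (F ∘ ρ) P :=
  ⟨fun i => (h.1 i).comp hρ hPR, fun _ hq => h.2 _ (hPR hq)⟩

/-- A family agreeing with a frame field on the region is a frame field there. [folklore] -/
theorem congr (h : IsFrameFieldOn G F R) (hΦ : ∀ q ∈ R, Φ q = F q) : IsFrameFieldOn G Φ R :=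
  ⟨fun i => (h.1 i).congr fun q hq => by simp only [hΦ q hq],
    fun q hq => (hΦ q hq) ▸ h.2 q hq⟩

/-- **Pasting frame fields along closed sets**: frame fields on closed regions `R`, `P` which
agree on `R ∩ P` paste (the one on `R` taking precedence) to a frame field on `R ∪ P`.
[folklore] -/
theorem union [DecidablePred (· ∈ R)] (hF : IsFrameFieldOn G F R) (hΦ : IsFrameFieldOn G Φ P)
    (hR : IsClosed R) (hPc : IsClosed P) (hagree : ∀ q ∈ R ∩ P, F q = Φ q) :
    IsFrameFieldOn G (R.piecewise F Φ) (R ∪ P) := by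
  have hF' : ∀ q ∈ R, R.piecewise F Φ q = F q := fun q hq => by
    simp only [Set.piecewise, if_pos hq]
  have hΦ' : ∀ q ∈ P, R.piecewise F Φ q = Φ q := fun q hq => by
    by_cases h : q ∈ R
    · simp only [Set.piecewise, if_pos h]
      exact hagree q ⟨h, hq⟩
    · simp only [Set.piecewise, if_neg h]
  refine ⟨fun i => ?_, fun q hq => ?_⟩
  · exact ((hF.1 i).congr fun q hq => by simp only [hF' q hq]).union_of_isClosed
      ((hΦ.1 i).congr fun q hq => by simp only [hΦ' q hq]) hR hPc
  · rcases hq with hq | hq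
    · rw [hF' q hq]
      exact hF.2 q hq
    · rw [hΦ' q hq]
      exact hΦ.2 q hq

/-- **The local step of the covering homotopy theorem** (Steenrod 1951, §11.3; Hatcher 2002,
proof of Prop. 4.48), for tangent frames: the chart transport of a frame field along `G` over `R`
by a map `ρ` (continuous on `C`, `ρ(C) ⊆ R`, `G(C) ∪ G(ρ(C))` inside the chart domain at `z`) is
a frame field along `G` over `C`. [folklore] -/
theorem transport (h : IsFrameFieldOn G F R) (hG : Continuous G) (z : M) {ρ : X → X}
    {C : Set X} (hρ : ContinuousOn ρ C) (hρR : MapsTo ρ C R)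
    (hC : ∀ q ∈ C, G q ∈ (chartAt (𝔼 m) z).source)
    (hCρ : ∀ q ∈ C, G (ρ q) ∈ (chartAt (𝔼 m) z).source) :
    IsFrameFieldOn G (frameChartTransportU (chartAt (𝔼 m) z) G F ρ) C := by
  set φ := chartAt (𝔼 m) z
  have hφd : φ.MDifferentiable (𝓡 m) (𝓡 m) := mdifferentiable_chart z
  have hφc : ContMDiffOn (𝓡 m) (𝓡 m) 1 φ φ.source := contMDiffOn_chart
  have hφc' : ContMDiffOn (𝓡 m) (𝓡 m) 1 φ.symm φ.target := contMDiffOn_chart_symm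
  -- the chart coordinates of the transported frame, continuous on `C`
  have ha : ∀ i, ContinuousOn (fun q => mfderiv (𝓡 m) (𝓡 m) φ (G (ρ q)) (F (ρ q) i)) C := by
    intro i
    have h1 : ContinuousOn (fun q => (TotalSpace.mk' (𝔼 m) (G (ρ q)) (F (ρ q) i) :
        TangentBundle (𝓡 m) M)) C :=
      (h.1 i).comp hρ hρR
    have h2 := ContinuousOn.totalSpaceMk_mfderiv (g := G ∘ ρ) φ.open_source hφc h1
      (fun q hq => hCρ q hq)
    exact continuous_snd_tangentBundle_euclidean.comp_continuousOn h2
  refine ⟨fun i => ?_, fun q hq => ?_⟩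
  · have hin : ContinuousOn (fun q => (TotalSpace.mk' (𝔼 m) (φ (G q))
        (mfderiv (𝓡 m) (𝓡 m) φ (G (ρ q)) (F (ρ q) i)) : TangentBundle (𝓡 m) (𝔼 m))) C :=
      ContinuousOn.totalSpaceMk_euclidean
        (φ.continuousOn.comp hG.continuousOn fun q hq => hC q hq) (ha i)
    have := ContinuousOn.totalSpaceMk_mfderiv (g := φ ∘ G) φ.open_target hφc' hin
      (fun q hq => φ.map_source (hC q hq))
    refine this.congr fun q hq => ?_
    change (TotalSpace.mk' (𝔼 m) (G q) _ : TangentBundle (𝓡 m) M) =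
      TotalSpace.mk' (𝔼 m) (φ.symm (φ (G q))) _
    rw [φ.left_inv (hC q hq)]
    rfl
  · -- linear independence: push `F (ρ q)` forward by the injective maps `dφ`, `dφ⁻¹`
    have hli1 : LinearIndependent ℝ fun i => mfderiv (𝓡 m) (𝓡 m) φ (G (ρ q)) (F (ρ q) i) := by
      let D : (𝔼 m) →L[ℝ] (𝔼 m) := mfderiv (𝓡 m) (𝓡 m) φ (G (ρ q))
      have hinj : Injective D.toLinearMap := hφd.mfderiv_injective (hCρ q hq)
      exact (h.2 _ (hρR hq)).map' D.toLinearMap (LinearMap.ker_eq_bot.mpr hinj)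
    let D' : (𝔼 m) →L[ℝ] (𝔼 m) := mfderiv (𝓡 m) (𝓡 m) φ.symm (φ (G q))
    have hinj' : Injective D'.toLinearMap :=
      hφd.symm.mfderiv_injective (φ.map_source (hC q hq))
    exact hli1.map' D'.toLinearMap (LinearMap.ker_eq_bot.mpr hinj')

omit [TopologicalSpace X] in
/-- The chart transport does not move a frame sitting on the front: if `ρ q = q` and `G q` lies in
the chart domain then the transported frame at `q` is `F q` (`dφ⁻¹ ∘ dφ = id`). [folklore] -/
theorem _root_.Literature.Topology.FourManifolds.frameChartTransportU_eq_self (z : M) {ρ : X → X}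
    {q : X} (hq : ρ q = q) (hGq : G q ∈ (chartAt (𝔼 m) z).source) :
    frameChartTransportU (chartAt (𝔼 m) z) G F ρ q = F q := by
  funext i
  have key : mfderiv (𝓡 m) (𝓡 m) (chartAt (𝔼 m) z).symm (chartAt (𝔼 m) z (G q))
      (mfderiv (𝓡 m) (𝓡 m) (chartAt (𝔼 m) z) (G q) (F q i)) = F q i :=
    DFunLike.congr_fun ((mdifferentiable_chart z).symm_comp_deriv hGq) (F q i)
  change mfderiv (𝓡 m) (𝓡 m) (chartAt (𝔼 m) z).symm (chartAt (𝔼 m) z (G q))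
    (mfderiv (𝓡 m) (𝓡 m) (chartAt (𝔼 m) z) (G (ρ q)) (F (ρ q) i)) = F q i
  rw [hq]
  exact key

end IsFrameFieldOn

/-- A tangent framing along `f` (tree predicate `HasTangentFramingAlong`) is a frame field along
`f` over `univ`, indexed by `Fin (finrank ℝ ℝᵐ)`. [folklore] -/
theorem HasTangentFramingAlong.exists_isFrameFieldOn {f : X → M}
    (h : HasTangentFramingAlong (𝓡 m) M f) :
    ∃ F : X → Fin (finrank ℝ (𝔼 m)) → 𝔼 m, IsFrameFieldOn f F univ := by
  obtain ⟨s, hs, hsli⟩ := h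
  exact ⟨fun q i => s i q, fun i => (hs i).continuousOn, fun q _ => hsli q⟩

/-- Conversely, a frame field along `f` over `univ` indexed by `Fin (finrank ℝ ℝᵐ)` is a tangent
framing along `f`. [folklore] -/
theorem IsFrameFieldOn.hasTangentFramingAlong {f : X → M} {F : X → Fin (finrank ℝ (𝔼 m)) → 𝔼 m}
    (h : IsFrameFieldOn f F univ) : HasTangentFramingAlong (𝓡 m) M f :=
  ⟨fun i q => F q i, fun i => continuousOn_univ.mp (h.1 i), fun q => h.2 q (mem_univ q)⟩

end FrameField

/-! ### The covering homotopy theorem for tangent frames -/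

section CoveringHomotopy

variable {m : ℕ} {M : Type*} [TopologicalSpace M] [ChartedSpace (𝔼 m) M] [IsManifold (𝓡 m) 1 M]
  {K : Type*} [TopologicalSpace K] [CompactSpace K] [TopologicalSpace.MetrizableSpace K]

/-- **Covering homotopy theorem for tangent frames** (Steenrod, *The Topology of Fibre Bundles*
(1951), §11.3, first covering homotopy theorem, for the frame bundle of `TM` and a compact
metrisable parameter space; Hatcher, *Algebraic Topology*, Prop. 4.48). Let `M` be a `C¹` manifold
modelled on `ℝᵐ`, `K` a compact metrisable space and `G : [0, 1] × K → M` a homotopy. If `TM` is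
framed along `G(0, ·)` then it is framed along `G(1, ·)`. The proof is, word for word, that of the
stable version `HasStableTangentFramingAlong.homotopy` (Lebesgue number `δ` of the cover of
`[0,1] × K` by preimages of chart domains; induction over the slabs `{t ≤ min(kδ/2, 1)}`; inside a
slab, induction over finite sets of indices of a partition of unity subordinate to a finite cover
of `K` by `δ`-balls, extending the frame field over the moving fronts by chart transport and
pasting along closed sets). [folklore] -/
theorem HasTangentFramingAlong.homotopy (G : C(I × K, M))
    (h0 : HasTangentFramingAlong (𝓡 m) M (fun y => G (0, y))) :
    HasTangentFramingAlong (𝓡 m) M (fun y => G (1, y)) := by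
  classical
  letI : MetricSpace K := TopologicalSpace.metrizableSpaceMetric K
  -- a Lebesgue number for the cover of `I × K` by the preimages of the chart domains
  obtain ⟨δ, hδ, hcov⟩ : ∃ δ > 0, ∀ q : I × K, ∃ z : M,
      ball q δ ⊆ G ⁻¹' (chartAt (𝔼 m) z).source := by
    obtain ⟨δ, hδ, h⟩ := lebesgue_number_lemma_of_metric (ι := M)
      (c := fun z => G ⁻¹' (chartAt (𝔼 m) z).source) isCompact_univ
      (fun z => (chartAt (𝔼 m) z).open_source.preimage G.continuous)
      (fun q _ => mem_iUnion.mpr ⟨G q, mem_chart_source _ _⟩)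
    exact ⟨δ, hδ, fun q => h q (mem_univ q)⟩
  -- time levels `a k = min (k ε) 1`, `ε = δ / 2`, and the slabs `R k = {t ≤ a k}`
  set ε : ℝ := δ / 2 with hε
  have hε0 : 0 < ε := half_pos hδ
  have hεδ : ε < δ := half_lt_self hδ
  let a : ℕ → ℝ := fun k => min (k * ε) 1
  have ha0 : ∀ k, 0 ≤ a k := fun k => le_min (by positivity) zero_le_one
  have ha1 : ∀ k, a k ≤ 1 := fun k => min_le_right _ _
  have hmono : ∀ k, a k ≤ a (k + 1) := fun k =>
    min_le_min_right _ (by push_cast; nlinarith [hε0])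
  have hstep : ∀ k, a (k + 1) ≤ a k + ε := by
    intro k
    change min (((k + 1 : ℕ) : ℝ) * ε) 1 ≤ min ((k : ℝ) * ε) 1 + ε
    rcases le_total ((k : ℝ) * ε) 1 with h | h
    · rw [min_eq_left h]
      refine (min_le_left _ _).trans ?_
      push_cast
      linarith
    · rw [min_eq_right h]
      exact (min_le_right _ _).trans (le_add_of_nonneg_right hε0.le)
  let R : ℕ → Set (I × K) := fun k => {q | (q.1 : ℝ) ≤ a k}
  -- the main induction over slabs
  have main : ∀ k, ∃ F : I × K → Fin (finrank ℝ (𝔼 m)) → 𝔼 m, IsFrameFieldOn G F (R k) := by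
    intro k
    induction k with
    | zero =>
      obtain ⟨F₀, hF₀⟩ := h0.exists_isFrameFieldOn
      refine ⟨fun q => F₀ q.2, fun i => ?_, fun q _ => hF₀.2 q.2 (mem_univ _)⟩
      have hc : Continuous fun q : I × K =>
          (TotalSpace.mk' (𝔼 m) (G (0, q.2)) (F₀ q.2 i) : TangentBundle (𝓡 m) M) :=
        (continuousOn_univ.mp (hF₀.1 i)).comp continuous_snd
      have ha00 : a 0 = 0 := by
        change min (((0 : ℕ) : ℝ) * ε) 1 = 0
        rw [Nat.cast_zero, zero_mul, min_eq_left (zero_le_one' ℝ)]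
      refine hc.continuousOn.congr fun q hq => ?_
      obtain ⟨t, y⟩ := q
      have ht : (t : ℝ) ≤ a 0 := hq
      rw [ha00] at ht
      have ht0 : t = 0 := Subtype.ext (le_antisymm ht t.2.1)
      subst ht0
      rfl
    | succ k ih =>
      obtain ⟨F, hF⟩ := ih
      have hA0 : 0 ≤ a k := ha0 k
      have hAA' : a k ≤ a (k + 1) := hmono k
      have hA'A : a (k + 1) ≤ a k + ε := hstep k
      have hA'1 : a (k + 1) ≤ 1 := ha1 (k + 1)
      let tA : I := ⟨a k, hA0, ha1 k⟩
      -- a finite cover of `K` by `δ`-balls and a chart domain over each `[a k, a (k+1)] × ball`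
      obtain ⟨t, ht⟩ : ∃ t : Finset K, (univ : Set K) ⊆ ⋃ y ∈ t, ball y δ :=
        isCompact_univ.elim_finite_subcover (fun y : K => ball y δ) (fun _ => isOpen_ball)
          fun y _ => mem_iUnion.mpr ⟨y, mem_ball_self hδ⟩
      choose z hz using fun y : K => hcov (tA, y)
      have hsrc : ∀ (c : K) (q : I × K), q.2 ∈ ball c δ → a k ≤ q.1 → (q.1 : ℝ) ≤ a (k + 1) →
          G q ∈ (chartAt (𝔼 m) (z c)).source := by
        intro c q hy h1 h2
        have hq : q ∈ ball (tA, c) δ := by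
          rw [← ball_prod_same]
          refine ⟨?_, hy⟩
          rw [mem_ball, Subtype.dist_eq, Real.dist_eq]
          change |(q.1 : ℝ) - a k| < δ
          rw [abs_of_nonneg (sub_nonneg.mpr h1)]
          linarith
        exact hz c hq
      -- a partition of unity on `K` subordinate to the balls, indexed by the centres
      obtain ⟨τ, hτ⟩ : ∃ τ : PartitionOfUnity (↥t) K univ,
          τ.IsSubordinate fun c => ball (c : K) δ := by
        refine PartitionOfUnity.exists_isSubordinate isClosed_univ _ (fun _ => isOpen_ball) ?_
        intro y _
        have := ht (mem_univ y)
        simp only [mem_iUnion] at this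
        obtain ⟨c, hc, hyc⟩ := this
        exact mem_iUnion.mpr ⟨⟨c, hc⟩, hyc⟩
      -- the fronts `fr J = a k + (a (k+1) - a k) Σ_{j ∈ J} τ j`
      let fr : Finset (↥t) → K → ℝ := fun J y => a k + (a (k + 1) - a k) * ∑ j ∈ J, τ j y
      have hfrc : ∀ J, Continuous (fr J) := fun J => by
        change Continuous fun y => a k + (a (k + 1) - a k) * ∑ j ∈ J, τ j y
        exact continuous_const.add (continuous_const.mul
          (continuous_finsetSum J fun j _ => (τ j).continuous))
      have hfrA : ∀ J y, a k ≤ fr J y := fun J y =>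
        le_add_of_nonneg_right (mul_nonneg (sub_nonneg.mpr hAA')
          (Finset.sum_nonneg fun j _ => τ.nonneg j y))
      have hfrA' : ∀ J y, fr J y ≤ a (k + 1) := fun J y => by
        have h1 : ∑ j ∈ J, τ j y ≤ 1 :=
          (Finset.sum_le_univ_sum_of_nonneg fun j => τ.nonneg j y).trans
            (by rw [← finsum_eq_sum_of_fintype]; exact τ.sum_le_one y)
        have h2 : (a (k + 1) - a k) * ∑ j ∈ J, τ j y ≤ (a (k + 1) - a k) * 1 :=
          mul_le_mul_of_nonneg_left h1 (sub_nonneg.mpr hAA')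
        change a k + (a (k + 1) - a k) * ∑ j ∈ J, τ j y ≤ a (k + 1)
        linarith
      -- induction over finite sets of indices
      have inner : ∀ J : Finset (↥t), ∃ F' : I × K → Fin (finrank ℝ (𝔼 m)) → 𝔼 m,
          IsFrameFieldOn G F' {q : I × K | (q.1 : ℝ) ≤ fr J q.2} := by
        intro J
        induction J using Finset.induction_on with
        | empty =>
          refine ⟨F, ?_⟩
          have : {q : I × K | (q.1 : ℝ) ≤ fr ∅ q.2} = R k := by
            ext q
            simp [fr, R]
          rw [this]
          exact hF
        | insert j J hj ihJ =>
          obtain ⟨F₁, hF₁⟩ := ihJ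
          have hfrins : ∀ y, fr (insert j J) y = fr J y + (a (k + 1) - a k) * τ j y := fun y => by
            simp only [fr, Finset.sum_insert hj]
            ring
          have hfrle : ∀ y, fr J y ≤ fr (insert j J) y := fun y => by
            rw [hfrins]
            exact le_add_of_nonneg_right (mul_nonneg (sub_nonneg.mpr hAA') (τ.nonneg j y))
          -- the old region, the retraction onto its front, and the patch
          set Rfr : Set (I × K) := {q | (q.1 : ℝ) ≤ fr J q.2} with hRfr
          have hRc : IsClosed Rfr :=
            isClosed_le (continuous_subtype_val.comp continuous_fst) ((hfrc J).comp continuous_snd)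
          let ρ : I × K → I × K := fun q =>
            (⟨fr J q.2, hA0.trans (hfrA J q.2), (hfrA' J q.2).trans hA'1⟩, q.2)
          have hρ : Continuous ρ :=
            (((hfrc J).comp continuous_snd).subtype_mk _).prodMk continuous_snd
          have hρR : MapsTo ρ univ Rfr := fun q _ => le_refl (fr J q.2)
          let P : Set (I × K) :=
            {q | fr J q.2 ≤ q.1 ∧ (q.1 : ℝ) ≤ fr (insert j J) q.2 ∧ q.2 ∈ tsupport (τ j)}
          have hPc : IsClosed P := by
            refine (isClosed_le ((hfrc J).comp continuous_snd)
              (continuous_subtype_val.comp continuous_fst)).inter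
              ((isClosed_le (continuous_subtype_val.comp continuous_fst)
                ((hfrc _).comp continuous_snd)).inter ?_)
            exact (isClosed_tsupport _).preimage continuous_snd
          have hPsrc : ∀ q ∈ P, G q ∈ (chartAt (𝔼 m) (z j)).source := fun q hq =>
            hsrc j q (hτ j hq.2.2) ((hfrA J q.2).trans hq.1) (hq.2.1.trans (hfrA' _ q.2))
          have hPρsrc : ∀ q ∈ P, G (ρ q) ∈ (chartAt (𝔼 m) (z j)).source := fun q hq =>
            hsrc j (ρ q) (hτ j hq.2.2) (hfrA J q.2) (hfrA' J q.2)
          -- the transported frame on the patch, pasted to the old one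
          have hT : IsFrameFieldOn G (frameChartTransportU (chartAt (𝔼 m) (z j)) G F₁ ρ) P :=
            hF₁.transport G.continuous (z j) hρ.continuousOn (fun q _ => hρR (mem_univ q))
              hPsrc hPρsrc
          have hagree : ∀ q ∈ Rfr ∩ P,
              F₁ q = frameChartTransportU (chartAt (𝔼 m) (z j)) G F₁ ρ q := by
            rintro q ⟨hq1, hq2⟩
            have heq : ρ q = q := by
              obtain ⟨s, y⟩ := q
              have h1 : (s : ℝ) ≤ fr J y := hq1
              have h2 : fr J y ≤ (s : ℝ) := hq2.1
              exact Prod.ext (Subtype.ext (le_antisymm h2 h1)) rfl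
            exact (frameChartTransportU_eq_self (z j) heq (hPsrc q hq2)).symm
          have hU := hF₁.union hT hRc hPc hagree
          refine ⟨Rfr.piecewise F₁ (frameChartTransportU (chartAt (𝔼 m) (z j)) G F₁ ρ), ?_⟩
          have hset : {q : I × K | (q.1 : ℝ) ≤ fr (insert j J) q.2} = Rfr ∪ P := by
            ext q
            simp only [hRfr, mem_setOf_eq, mem_union, P]
            constructor
            · intro hq
              by_cases h : (q.1 : ℝ) ≤ fr J q.2
              · exact Or.inl h
              · refine Or.inr ⟨(not_le.mp h).le, hq, ?_⟩
                apply subset_tsupport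
                rw [mem_support]
                intro h0
                rw [hfrins, h0, mul_zero, add_zero] at hq
                exact h hq
            · rintro (hq | ⟨-, hq, -⟩)
              · exact hq.trans (hfrle q.2)
              · exact hq
          rw [hset]
          exact hU
      -- `J = univ`: the front is `t = a (k + 1)`
      obtain ⟨F', hF'⟩ := inner Finset.univ
      refine ⟨F', ?_⟩
      have hset : R (k + 1) = {q : I × K | (q.1 : ℝ) ≤ fr Finset.univ q.2} := by
        ext q
        have h1 : ∑ j, τ j q.2 = 1 := by
          rw [← finsum_eq_sum_of_fintype]
          exact τ.sum_eq_one (mem_univ q.2)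
        simp only [R, fr, mem_setOf_eq, h1, mul_one]
        constructor <;> intro h <;> linarith
      rw [hset]
      exact hF'
  -- a slab index `k₀` with `k₀ ε ≥ 1`: the slab is everything
  obtain ⟨k₀, hk₀⟩ : ∃ k₀ : ℕ, 1 ≤ (k₀ : ℝ) * ε := by
    obtain ⟨k₀, hk₀⟩ := exists_nat_ge (1 / ε)
    exact ⟨k₀, by rwa [div_le_iff₀ hε0] at hk₀⟩
  have hR : R k₀ = univ := by
    refine eq_univ_of_forall fun q => ?_
    change (q.1 : ℝ) ≤ min ((k₀ : ℝ) * ε) 1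
    rw [min_eq_right hk₀]
    exact q.1.2.2
  obtain ⟨F, hF⟩ := main k₀
  rw [hR] at hF
  exact (hF.comp (ρ := fun y : K => ((1 : I), y)) (P := univ) (by fun_prop)
    (mapsTo_univ _ _)).hasTangentFramingAlong

/-- **`TM` is framed along every null-homotopic map of a compact metrisable space** into a `C¹`
manifold modelled on `ℝᵐ`: a constant map is framed by the chart frame at the point
(`hasTangentFramingAlong_of_mem_maximalAtlas`), and the framing propagates along the null-homotopy
(`HasTangentFramingAlong.homotopy`). Equivalently: the pull-back of `TM` along a null-homotopic map
is trivial (Steenrod 1951, §11.5–11.6). [folklore] -/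
theorem HasTangentFramingAlong.of_homotopic_const {f : C(K, M)} {x₀ : M}
    (h : f.Homotopic (ContinuousMap.const K x₀)) : HasTangentFramingAlong (𝓡 m) M f := by
  obtain ⟨H⟩ := h.symm
  -- the constant map is framed
  have h0 : HasTangentFramingAlong (𝓡 m) M (fun _ : K => x₀) := by
    have he : chartAt (𝔼 m) x₀ ∈ IsManifold.maximalAtlas (𝓡 m) 1 M :=
      IsManifold.chart_mem_maximalAtlas x₀
    have hfr := hasTangentFramingAlong_of_mem_maximalAtlas he
    exact hfr.comp ⟨fun _ : K => (⟨x₀, mem_chart_source _ x₀⟩ : (chartAt (𝔼 m) x₀).source),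
      continuous_const⟩
  have h0' : HasTangentFramingAlong (𝓡 m) M (fun y => H.toContinuousMap (0, y)) := by
    convert h0 using 1
    funext y
    exact H.apply_zero y
  have h1 := HasTangentFramingAlong.homotopy H.toContinuousMap h0'
  convert h1 using 1
  funext y
  exact (H.apply_one y).symm

end CoveringHomotopy

/-! ### Framing the tangent bundle off a point with contractible complement -/

section Puncture

variable {m : ℕ} {M : Type*} [TopologicalSpace M] [ChartedSpace (𝔼 m) M] [IsManifold (𝓡 m) 1 M]

/-- **If `M ∖ {p}` is contractible then `TM` is trivial over `M ∖ {p}`** (`M` a compact metrisable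
`C¹` manifold modelled on `ℝᵐ`; "bundles over contractible bases are trivial", Steenrod 1951,
§11.6). *Proof* (that of the stable version
`hasStableTangentFramingAlong_compl_singleton_of_contractibleSpace`, verbatim for frames of `TM`):
with `φ` the chart at `p`, `O = φ⁻¹(B(φ p, r)) ∋ p` an open chart ball with `B̄ ⊆ φ.target` and
`D = φ⁻¹(B̄)`, the compact `Oᶜ ⊆ M ∖ {p}` includes null-homotopically into `M`, so `TM` is framed
along it (`HasTangentFramingAlong.of_homotopic_const`); on the punctured closed ball `D ∖ {p}` take
the chart transport of that frame along the radial projection onto the sphere `φ⁻¹(S(φ p, r)) ⊆ Oᶜ`;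
the two pieces agree on `Oᶜ ∩ D` and paste along closed sets of `M ∖ {p}`. [folklore] -/
theorem hasTangentFramingAlong_compl_singleton_of_contractibleSpace [T2Space M]
    [CompactSpace M] [TopologicalSpace.MetrizableSpace M] (p : M)
    (hc : ContractibleSpace ↥(({p} : Set M)ᶜ)) :
    HasTangentFramingAlong (𝓡 m) M ((↑) : ((({p} : Set M)ᶜ : Set M)) → M) := by
  classical
  let φ := chartAt (𝔼 m) p
  let b : 𝔼 m := φ p
  have hps : p ∈ φ.source := mem_chart_source _ p
  obtain ⟨r, hr, hball⟩ : ∃ r > (0 : ℝ), closedBall b r ⊆ φ.target := by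
    obtain ⟨r, hr, h⟩ := Metric.isOpen_iff.mp φ.open_target b (mem_chart_target _ p)
    exact ⟨r / 2, half_pos hr, (closedBall_subset_ball (half_lt_self hr)).trans h⟩
  -- the open chart ball `O ∋ p` and the closed chart ball `D ⊇ O`
  let O : Set M := φ.source ∩ φ ⁻¹' ball b r
  have hO : IsOpen O := φ.isOpen_inter_preimage isOpen_ball
  have hpO : p ∈ O := ⟨hps, mem_ball_self hr⟩
  have hKU : Oᶜ ⊆ (({p} : Set M)ᶜ : Set M) :=
    compl_subset_compl.mpr (singleton_subset_iff.mpr hpO)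
  let D : Set M := φ.symm '' closedBall b r
  have hD : IsClosed D :=
    ((isCompact_closedBall b r).image_of_continuousOn (φ.continuousOn_symm.mono hball)).isClosed
  have hOD : O ⊆ D := fun y hy => ⟨φ y, ball_subset_closedBall hy.2, φ.left_inv hy.1⟩
  have hDs : D ⊆ φ.source := by
    rintro _ ⟨x, hx, rfl⟩
    exact φ.map_target (hball hx)
  -- Step 1: `TM` is framed along the inclusion of the compact set `Oᶜ ⊆ M ∖ {p}`, which is
  -- null-homotopic in `M` because `M ∖ {p}` is contractible
  have hK : HasTangentFramingAlong (𝓡 m) M ((↑) : (Oᶜ : Set M) → M) := by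
    haveI : CompactSpace (Oᶜ : Set M) :=
      isCompact_iff_compactSpace.mp hO.isClosed_compl.isCompact
    haveI := hc
    let jK : C((Oᶜ : Set M), (({p} : Set M)ᶜ : Set M)) :=
      ⟨Set.inclusion hKU, continuous_inclusion hKU⟩
    let v : C((({p} : Set M)ᶜ : Set M), M) := ⟨Subtype.val, continuous_subtype_val⟩
    obtain ⟨u₀, hu⟩ := id_nullhomotopic (({p} : Set M)ᶜ : Set M)
    have h1 := (ContinuousMap.Homotopic.refl v).comp (hu.comp (ContinuousMap.Homotopic.refl jK))
    have h2 : v.comp ((ContinuousMap.const _ u₀).comp jK) =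
        ContinuousMap.const (Oᶜ : Set M) (u₀ : M) := by
      ext y
      rfl
    rw [h2] at h1
    exact HasTangentFramingAlong.of_homotopic_const h1
  -- the framing as a total function `s'` on `M`: a frame field over `Oᶜ`
  obtain ⟨F₀, hF₀⟩ := hK.exists_isFrameFieldOn
  let s' : M → Fin (finrank ℝ (𝔼 m)) → 𝔼 m := fun y => if h : y ∈ O then 0 else F₀ ⟨y, h⟩
  have hs'eq : ∀ y : (Oᶜ : Set M), s' y = F₀ y := fun y => by
    simp only [s', dif_neg (show ¬ ((y : M) ∈ O) from y.2)]
  have hS' : IsFrameFieldOn (id : M → M) s' Oᶜ := by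
    refine ⟨fun i => ?_, fun y hy => ?_⟩
    · rw [continuousOn_iff_continuous_restrict]
      convert continuousOn_univ.mp (hF₀.1 i) using 1
      funext y
      change (TotalSpace.mk' (𝔼 m) (y : M) (s' y i) : TangentBundle (𝓡 m) M) =
        TotalSpace.mk' (𝔼 m) (y : M) (F₀ y i)
      rw [hs'eq]
    · rw [show s' y = F₀ ⟨y, hy⟩ from hs'eq ⟨y, hy⟩]
      exact hF₀.2 _ (mem_univ _)
  -- Step 2: the radial projection `pr` of the punctured closed chart ball `D ∖ {p}` onto the
  -- sphere `φ⁻¹(S(b, r)) ⊆ Oᶜ`, and the chart transport `A` of `s'` along it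
  have hne : ∀ y ∈ D \ {p}, φ y - b ≠ 0 := by
    rintro y ⟨hyD, hyp⟩ h
    exact hyp (φ.injOn (hDs hyD) hps (sub_eq_zero.mp h))
  let pr : M → M := fun y => φ.symm (b + (r * ‖φ y - b‖⁻¹) • (φ y - b))
  have hpr_sphere : ∀ y ∈ D \ {p}, b + (r * ‖φ y - b‖⁻¹) • (φ y - b) ∈ sphere b r := by
    intro y hy
    rw [mem_sphere, dist_eq_norm, add_sub_cancel_left, norm_smul, Real.norm_eq_abs,
      abs_of_pos (mul_pos hr (inv_pos.mpr (norm_pos_iff.mpr (hne y hy)))),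
      inv_mul_cancel_right₀ (norm_ne_zero_iff.mpr (hne y hy))]
  have hprt : ∀ y ∈ D \ {p}, b + (r * ‖φ y - b‖⁻¹) • (φ y - b) ∈ φ.target := fun y hy =>
    hball (sphere_subset_closedBall (hpr_sphere y hy))
  have hprC : ContinuousOn pr (D \ {p}) := by
    have hφ : ContinuousOn φ (D \ {p}) := φ.continuousOn.mono fun y hy => hDs hy.1
    have hsub : ContinuousOn (fun y => φ y - b) (D \ {p}) := hφ.sub continuousOn_const
    have hinv : ContinuousOn (fun y => ‖φ y - b‖⁻¹) (D \ {p}) :=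
      hsub.norm.inv₀ fun y hy => norm_ne_zero_iff.mpr (hne y hy)
    have hcoef : ContinuousOn (fun y => r * ‖φ y - b‖⁻¹) (D \ {p}) :=
      continuousOn_const.mul hinv
    have hsm : ContinuousOn (fun y => (r * ‖φ y - b‖⁻¹) • (φ y - b)) (D \ {p}) :=
      hcoef.smul hsub
    have h1 : ContinuousOn (fun y => b + (r * ‖φ y - b‖⁻¹) • (φ y - b)) (D \ {p}) :=
      continuousOn_const.add hsm
    exact φ.continuousOn_symm.comp h1 fun y hy => hprt y hy
  have hprs : ∀ y ∈ D \ {p}, pr y ∈ φ.source := fun y hy => φ.map_target (hprt y hy)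
  have hprO : MapsTo pr (D \ {p}) Oᶜ := by
    intro y hy hO'
    have h1 : φ (pr y) = b + (r * ‖φ y - b‖⁻¹) • (φ y - b) := φ.right_inv (hprt y hy)
    have h2 : φ (pr y) ∈ ball b r := hO'.2
    rw [h1] at h2
    exact (ne_of_lt (mem_ball.mp h2)) (mem_sphere.mp (hpr_sphere y hy))
  have hA : IsFrameFieldOn (id : M → M) (frameChartTransportU φ id s' pr) (D \ {p}) :=
    hS'.transport continuous_id p hprC hprO (fun y hy => hDs hy.1) (fun y hy => hprs y hy)
  -- on `Oᶜ ∩ D` (the preimage of the sphere) `pr = id`, so that `A = s'` there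
  have hprfix : ∀ y ∈ Oᶜ ∩ D, pr y = y := by
    rintro y ⟨hyO, x, hx, rfl⟩
    have hxt : x ∈ φ.target := hball hx
    have hxr : ‖x - b‖ = r := by
      refine le_antisymm (mem_closedBall_iff_norm.mp hx)
        (not_lt.mp fun hlt => hyO ⟨φ.map_target hxt, ?_⟩)
      change φ (φ.symm x) ∈ ball b r
      rw [φ.right_inv hxt]
      exact mem_ball_iff_norm.mpr hlt
    change φ.symm (b + (r * ‖φ (φ.symm x) - b‖⁻¹) • (φ (φ.symm x) - b)) = φ.symm x
    rw [φ.right_inv hxt, hxr, mul_inv_cancel₀ hr.ne', one_smul, add_sub_cancel]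
  -- Step 3: pull both pieces back to the subtype `M ∖ {p}`, where they live on closed sets
  -- covering everything, and paste
  have hR : IsFrameFieldOn (id ∘ ((↑) : (({p} : Set M)ᶜ : Set M) → M)) (s' ∘ (↑))
      ((↑) ⁻¹' Oᶜ) :=
    hS'.comp continuous_subtype_val.continuousOn fun x hx => hx
  have hP : IsFrameFieldOn (id ∘ ((↑) : (({p} : Set M)ᶜ : Set M) → M))
      (frameChartTransportU φ id s' pr ∘ (↑)) ((↑) ⁻¹' D) :=
    hA.comp continuous_subtype_val.continuousOn fun x hx => ⟨hx, x.2⟩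
  have hRc : IsClosed (((↑) : (({p} : Set M)ᶜ : Set M) → M) ⁻¹' Oᶜ) :=
    hO.isClosed_compl.preimage continuous_subtype_val
  have hPc : IsClosed (((↑) : (({p} : Set M)ᶜ : Set M) → M) ⁻¹' D) :=
    hD.preimage continuous_subtype_val
  have hagree : ∀ x ∈ ((↑) : (({p} : Set M)ᶜ : Set M) → M) ⁻¹' Oᶜ ∩ (↑) ⁻¹' D,
      (s' ∘ (↑)) x = (frameChartTransportU φ id s' pr ∘ (↑)) x := by
    rintro x ⟨hxO, hxD⟩
    exact (frameChartTransportU_eq_self p (hprfix x ⟨hxO, hxD⟩) (hDs hxD)).symm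
  have hU := hR.union hP hRc hPc hagree
  have huniv : ((↑) : (({p} : Set M)ᶜ : Set M) → M) ⁻¹' Oᶜ ∪ (↑) ⁻¹' D = univ := by
    refine eq_univ_of_forall fun x => ?_
    by_cases hx : (x : M) ∈ O
    · exact Or.inr (hOD hx)
    · exact Or.inl hx
  rw [huniv] at hU
  exact hU.hasTangentFramingAlong

end Puncture

/-! ### The punctured homotopy 4-sphere -/

section HomotopySphereFour

/-- Local notation: `𝕊 n` is the unit sphere in `EuclideanSpace ℝ (Fin (n + 1))`. -/
local notation "𝕊 " n:arg => Metric.sphere (0 : EuclideanSpace ℝ (Fin (n + 1))) 1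

/-- **The tangent bundle of a homotopy 4-sphere is trivial off any point**: for a Hausdorff
second-countable smooth 4-manifold `M ≃ₕ S⁴` and `q ∈ M`, `TM` is framed over `M ∖ {q}` — `M` is
compact (`compactSpace_of_homotopyEquiv_sphere_four_holds`), metrisable, and `M ∖ {q}` is
contractible (`contractibleSpace_compl_singleton_of_homotopyEquiv_sphere_four`, Freedman 1982,
proof of Thm. 1.6, p. 371), so `hasTangentFramingAlong_compl_singleton_of_contractibleSpace`
applies. [folklore] -/
theorem hasTangentFramingAlong_compl_singleton_of_homotopyEquiv_sphere_four (M : Type)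
    [TopologicalSpace M] [T2Space M] [SecondCountableTopology M] [ChartedSpace (𝔼 4) M]
    [IsManifold (𝓡 4) ∞ M] (e : M ≃ₕ (𝕊 4)) (q : M) :
    HasTangentFramingAlong (𝓡 4) M ((↑) : ((({q} : Set M)ᶜ : Set M)) → M) := by
  haveI : CompactSpace M := compactSpace_of_homotopyEquiv_sphere_four_holds M e
  haveI : TopologicalSpace.MetrizableSpace M := Manifold.metrizableSpace (𝓡 4) M
  exact hasTangentFramingAlong_compl_singleton_of_contractibleSpace q
    (contractibleSpace_compl_singleton_of_homotopyEquiv_sphere_four M e q)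

/-- **A homotopy 4-sphere minus a point is parallelizable**: the open submanifold
`M ∖ {q} : TopologicalSpace.Opens M` (Mathlib's induced charts) of a Hausdorff second-countable
smooth 4-manifold `M ≃ₕ S⁴` is parallelizable — the framing of `TM` over `M ∖ {q}` pulls back along
the open inclusion, an equidimensional immersion (`contMDiff_subtype_val`,
`OpenSubmanifold.mfderiv_subtype_val`, `IsParallelizable.of_hasTangentFramingAlong_of_isInvertible_mfderiv`).
[folklore] -/
theorem isParallelizable_opens_compl_singleton_of_homotopyEquiv_sphere_four (M : Type)
    [TopologicalSpace M] [T2Space M] [SecondCountableTopology M] [ChartedSpace (𝔼 4) M]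
    [IsManifold (𝓡 4) ∞ M] (e : M ≃ₕ (𝕊 4)) (q : M) :
    IsParallelizable (𝓡 4) (⟨({q} : Set M)ᶜ, isOpen_compl_singleton⟩ : TopologicalSpace.Opens M) := by
  set U : TopologicalSpace.Opens M := ⟨({q} : Set M)ᶜ, isOpen_compl_singleton⟩
  have hfr : HasTangentFramingAlong (𝓡 4) M ((↑) : U → M) :=
    hasTangentFramingAlong_compl_singleton_of_homotopyEquiv_sphere_four M e q
  refine IsParallelizable.of_hasTangentFramingAlong_of_isInvertible_mfderiv (φ := ((↑) : U → M))
    (contMDiff_subtype_val.of_le le_top) (fun x => ?_) hfr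
  rw [Literature.Geometry.Manifold.OpenSubmanifold.mfderiv_subtype_val]
  exact ⟨ContinuousLinearEquiv.refl ℝ _, rfl⟩

/-- **A smooth homotopy 4-sphere minus a point immerses in `ℝ⁴`** (Phillips 1967, Cor. 8.2 —
PROVED in the tree — applied to the parallelizable proper open subset `M ∖ {q}` of the connected
`M`): there is `F : M → ℝ⁴` which is a `C^∞` local diffeomorphism at every `x ≠ q`. This is the
immersion-theoretic half of the hypothesis of
`eliashberg_foldMap_homotopySphere_four_of_poleImmersion` (`HomotopyS4FoldMapProofs.lean`), without
the normalisation at the puncture. [cite: Phillips1967, Cor. 8.2 (p. 196)] -/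
theorem exists_isLocalDiffeomorphAt_compl_singleton_of_homotopyEquiv_sphere_four (M : Type)
    [TopologicalSpace M] [T2Space M] [SecondCountableTopology M] [ChartedSpace (𝔼 4) M]
    [IsManifold (𝓡 4) ∞ M] (e : M ≃ₕ (𝕊 4)) (q : M) :
    ∃ F : M → 𝔼 4, ∀ x, x ≠ q → IsLocalDiffeomorphAt (𝓡 4) (𝓡 4) ∞ F x := by
  -- `M` is connected: it is simply connected, being homotopy equivalent to `S⁴`
  haveI : SimplyConnectedSpace M := (simplyConnectedSpace_and_isZero_of_homotopyEquiv e).1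
  set U : TopologicalSpace.Opens M := ⟨({q} : Set M)ᶜ, isOpen_compl_singleton⟩
  have hUX : (U : Set M) ≠ univ := by
    intro h
    have : q ∈ (U : Set M) := h ▸ mem_univ q
    exact this rfl
  obtain ⟨F, hF⟩ := Literature.Topology.Immersions.exists_isLocalDiffeomorphAt_of_isOpen_of_ne_univ
    Literature.Topology.Immersions.Phillips1967_exists_isLocalDiffeomorph_of_isParallelizable_holds
    U hUX (isParallelizable_opens_compl_singleton_of_homotopyEquiv_sphere_four M e q)
  exact ⟨F, fun x hx => hF x hx⟩

end HomotopySphereFour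

end Literature.Topology.FourManifolds
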